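import Literature.Analysis.FluidPDE.BarkerPrangeConcentrationLimit
import Literature.Analysis.FluidPDE.WeakL3DataWeakCompactness
import Literature.Analysis.FluidPDE.WeakL3DataCaloricLimits
import HarnessLib

/-!
# The limiting procedure for local energy solutions with weak-`L³`-bounded data and a uniform
# initial layer (extraction step of Albritton–Barker 2019, Thm. 4.1)

Analysis/FluidPDE proof file (theorems only: no definition, no named fact, no `sorry`) on the
discharge path of the named fact
`Literature.Analysis.FluidPDE.AlbrittonBarker2019_liouville_weakL3_backward`
(`AncientL3BackwardLiouville.lean`; Albritton–Barker, J. Math. Fluid Mech. 21 (2019) =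
arXiv:1811.00502, **Thm. 4.1**). In the proof of Thm. 4.1 (arXiv p. 9) the blow-down solutions
`v^{(k)}` have data bounded in `L^{3,∞}` only, `‖v^{(k)}(·,−1)‖_{L^{3,∞}} ≤ M`, and "there exists a
subsequence such that `v^{(k)} → u` in `L³_loc(ℝ³ × ]−1, 0])`, `v^{(k)}(·,−1) ⇀* u(·,−1)` in
`L^{3,∞}`" by the weak-∗ stability of global weak `L^{3,∞}`-solutions (Barker–Seregin–Šverák
2018 = arXiv:1603.03211, Thm. 1.3, §3.2), whose analytic heart is the uniform initial layer,
Lemma 3.4 there. This file runs the extraction in the tree's language — Seregin's limiting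
procedure for local energy solutions (Seregin 2014, Ch. 7 §7.3, App. B §B.4; the tree's F1
`seregin2014_localEnergy_limitingProcedure_holds` and F2 `seregin2014_limit_decay_holds`), word
for word the model `BarkerPrange2020.exists_limit_localEnergySolution_of_le`
(`BarkerPrangeConcentrationLimit.lean`) — with two changes: the data are weak-`L³` fields with
`sup_t t³|{|v₀ⁿ| > t}| ≤ M` (their unit-ball energies are `≤ |B₁| + 2M`, and the caloric glue is
that of `L² + L^∞` data, `WeakL3DataCaloricLimits.lean`), and the limit datum is identified, by
the weak compactness of weak-`L³`-bounded data (`WeakL3DataWeakCompactness.lean`) and the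
uniqueness of weak limits, as an `L² + L⁴ ∩ L^∞` field — hence an `E²` field, which is what
Seregin's decay theorem F2 consumes. The uniform initial layer of the approximants enters as the
explicit hypothesis `hlay` (a bound `η(t) → 0` on `‖vⁿ(t) − W_t * v₀ⁿ‖_{L²(B(x₀,1))}`, all `n`,
`x₀`, `t`; for the blow-down sequence it is Barker–Seregin–Šverák's Lemma 3.4).

* `MemE2.congr_ae` — `E²` is invariant under a.e. modification;
* `exists_limit_localEnergySolution_weakL3` — the extraction theorem.

## References

* D. Albritton, T. Barker, arXiv:1811.00502, proof of Thm. 4.1 (p. 9). [`AlbrittonBarker2019`]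
* T. Barker, G. Seregin, V. Šverák, arXiv:1603.03211, Thm. 1.3, §3.2, Lemma 3.4.
  [`BarkerSeregin2016`]
* G. Seregin, *Lecture Notes on Regularity Theory for the Navier–Stokes Equations* (2014),
  Ch. 7 §7.3 (7.3.2)–(7.3.12), App. B §B.4. [`Seregin2014`]
* P. G. Lemarié-Rieusset, *The Navier–Stokes Problem in the 21st Century* (2016), proof of
  Thm. 15.5, pp. 570–571. [`LemarieRieusset2016`]
* H. Jia, V. Šverák, Invent. Math. 196 (2014) = arXiv:1204.0529, Lemma 3.1. [`JiaSverak2014`]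
-/

noncomputable section

open MeasureTheory Set Function Filter Metric Topology TopologicalSpace
open scoped ENNReal NNReal RealInnerProductSpace

namespace Literature.Analysis.FluidPDE

open BarkerPrange2020

/-! ### `E²` under a.e. modification -/

/-- **`E²` is a class of a.e.-equivalence classes**: if `u ∈ E²` and `v = u` a.e. is measurable,
then `v ∈ E²`. [folklore] -/
theorem MemE2.congr_ae {u v : EuclideanSpace ℝ (Fin 3) → EuclideanSpace ℝ (Fin 3)} (hu : MemE2 u)
    (huv : u =ᵐ[volume] v) (hv : AEStronglyMeasurable v volume) : MemE2 v := by
  have e : ∀ x₀ : EuclideanSpace ℝ (Fin 3),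
      ∫⁻ x in ball x₀ 1, ‖v x‖ₑ ^ 2 = ∫⁻ x in ball x₀ 1, ‖u x‖ₑ ^ 2 := fun x₀ =>
    lintegral_congr_ae (ae_restrict_of_ae (huv.mono fun x hx => by simp only [hx]))
  obtain ⟨C, hC⟩ := hu.uniformlyLocal
  refine ⟨hv, ⟨C, fun x₀ => (e x₀).le.trans (hC x₀)⟩, ?_⟩
  simp_rw [e]
  exact hu.decay

/-! ### The extraction theorem -/

/-- **Extraction of the limit local energy solution for weak-`L³`-bounded data with a uniform
initial layer** (the limiting procedure behind Albritton–Barker 2019, Thm. 4.1, in Seregin's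
class; Seregin 2014, Ch. 7 §7.3 and App. B §B.4; Barker–Seregin–Šverák 2018, §3.2). Given
`M ≥ 0` there is `σ₀ ∈ (0, 1)` (the time of Jia–Šverák's a priori estimate for unit-ball
energies `|B₁| + 2M`) such that for every `σ ∈ (0, σ₀]`, every `η → 0⁺` and every sequence of
unit-viscosity local energy solutions `(v₀ⁿ, vⁿ, πⁿ)` on `ℝ³ × (0, σ)` with weak-`L³` data,
`sup_t t³|{|v₀ⁿ| > t}| ≤ M`, and the uniform initial layer
`‖vⁿ(t) − W_t * v₀ⁿ‖_{L²(B(x₀,1))} ≤ η(t)`: the unit-ball energies and unit-cylinder dissipations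
of all `vⁿ` are bounded by one constant `C`, and a subsequence converges in `L²((0, σ) × B_R)`
for every `R`, and weakly at every time `t ∈ [0, σ]`, to a local energy solution `(u, p)` on
`ℝ³ × (0, σ)` whose datum `aL = u(0)` is weakly divergence free and lies in `E²`.
[cite: AlbrittonBarker2019, proof of Thm. 4.1 (arXiv:1811.00502 p. 9)] [cite: Seregin2014, Ch. 7 §7.3 (7.3.2)–(7.3.12) and App. B §B.4] -/
theorem exists_limit_localEnergySolution_weakL3 (M : ℝ≥0) :
    ∃ σ₀ : ℝ, 0 < σ₀ ∧ σ₀ < 1 ∧ ∀ σ : ℝ, 0 < σ → σ ≤ σ₀ →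
      ∀ (η : ℝ → ℝ≥0), Tendsto η (𝓝[>] 0) (𝓝 0) →
      ∀ (v₀ : ℕ → EuclideanSpace ℝ (Fin 3) → EuclideanSpace ℝ (Fin 3))
        (v : ℕ → ℝ → EuclideanSpace ℝ (Fin 3) → EuclideanSpace ℝ (Fin 3))
        (π : ℕ → ℝ → EuclideanSpace ℝ (Fin 3) → ℝ),
        (∀ n, IsLocalEnergySolutionOn σ 1 (v₀ n) (v n) (π n)) →
        (∀ n, FunctionSpaces.MemWeakLp (v₀ n) 3 volume) →
        (∀ n, FunctionSpaces.eWeakLpPow (v₀ n) 3 volume ≤ M) →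
        (∀ n, ∀ t ∈ Ioo 0 σ, ∀ x₀ : EuclideanSpace ℝ (Fin 3),
          eLpNorm (v n t - heatTest 1 (v₀ n) t) 2 (volume.restrict (ball x₀ 1)) ≤ η t) →
        ∃ (C : ℝ≥0) (φ : ℕ → ℕ) (aL : EuclideanSpace ℝ (Fin 3) → EuclideanSpace ℝ (Fin 3))
          (u : ℝ → EuclideanSpace ℝ (Fin 3) → EuclideanSpace ℝ (Fin 3))
          (p : ℝ → EuclideanSpace ℝ (Fin 3) → ℝ),
          StrictMono φ ∧ IsLocalEnergySolutionOn σ 1 aL u p ∧ IsWeaklyDivFree aL ∧ MemE2 aL ∧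
          (∀ t ∈ Icc 0 σ, ∀ ψ : EuclideanSpace ℝ (Fin 3) → EuclideanSpace ℝ (Fin 3),
            FunctionSpaces.IsTestFunctionOn (⊤ : Opens (EuclideanSpace ℝ (Fin 3))) ψ →
              Tendsto (fun k => ∫ x, ⟪v (φ k) t x, ψ x⟫) atTop (𝓝 (∫ x, ⟪u t x, ψ x⟫))) ∧
          (∀ n, ∀ᵐ t ∂(volume.restrict (Ioo 0 σ)), ∀ x₀ : EuclideanSpace ℝ (Fin 3),
            ∫⁻ x in ball x₀ 1, ‖v n t x‖ₑ ^ 2 ≤ C) ∧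
          (∀ n, ∃ G : ℝ → EuclideanSpace ℝ (Fin 3) → EuclideanSpace ℝ (Fin 3) →L[ℝ] EuclideanSpace ℝ (Fin 3),
            HasWeakSpatialGradientOn (slab (EuclideanSpace ℝ (Fin 3)) (Ioo 0 σ) isOpen_Ioo) (v n) G ∧
              ∀ x₀ : EuclideanSpace ℝ (Fin 3), ∫⁻ z in Ioo 0 σ ×ˢ ball x₀ 1,
                ENNReal.ofReal (frobeniusNormSq (G z.1 z.2)) ≤ C) ∧
          ∀ Rb : ℝ, 0 < Rb →
            Tendsto (fun k => ∫⁻ z in Ioo 0 σ ×ˢ ball (0 : EuclideanSpace ℝ (Fin 3)) Rb,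
              ‖v (φ k) z.1 z.2 - u z.1 z.2‖ₑ ^ 2) atTop (𝓝 0) := by
  -- ### the absolute constants of the a priori estimate and the time `σ₀`
  obtain ⟨ε₀, hε₀, hε₀1, C, hAP⟩ := JiaSverak2014.apriori_unit_scale_slab
  have hε₀' : (0 : ℝ) < ε₀ := by exact_mod_cast hε₀
  -- the unit-ball energy bound of weak-`L³` data: `|B₁| + 2M`
  set V : ℝ≥0∞ := volume (ball (0 : EuclideanSpace ℝ (Fin 3)) 1) with hV
  have hVtop : V ≠ ∞ := measure_ball_lt_top.ne
  set α : ℝ≥0 := V.toNNReal / 2 + M with hα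
  have h2α : 2 * (α : ℝ≥0∞) = V + 2 * (M : ℝ≥0∞) := by
    rw [hα, ENNReal.coe_add, ENNReal.coe_div (by norm_num), ENNReal.coe_toNNReal hVtop, mul_add,
      ENNReal.coe_ofNat, ENNReal.mul_div_cancel (by norm_num) ENNReal.ofNat_ne_top]
  set σ₀ : ℝ := min (1 / 2) (min ε₀ (ε₀ / ((α : ℝ) ^ 2 + 1))) with hσ₀
  have hσ₀pos : 0 < σ₀ := lt_min (by norm_num) (lt_min hε₀' (by positivity))
  refine ⟨σ₀, hσ₀pos, (min_le_left _ _).trans_lt (by norm_num), ?_⟩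
  intro σ hσ hσσ₀ η hη v₀ v π hv ha hWM hlay
  have hσε : σ ≤ ε₀ := hσσ₀.trans ((min_le_right _ _).trans (min_le_left _ _))
  have hσα : σ * (α : ℝ) ^ 2 ≤ (ε₀ : ℝ) := by
    have h1 : σ ≤ (ε₀ : ℝ) / ((α : ℝ) ^ 2 + 1) :=
      hσσ₀.trans ((min_le_right _ _).trans (min_le_right _ _))
    have h2 : (α : ℝ) ^ 2 ≤ (α : ℝ) ^ 2 + 1 := by linarith
    calc σ * (α : ℝ) ^ 2 ≤ (ε₀ : ℝ) / ((α : ℝ) ^ 2 + 1) * ((α : ℝ) ^ 2 + 1) :=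
          mul_le_mul h1 h2 (by positivity) (by positivity)
      _ = (ε₀ : ℝ) := by field_simp
  -- ### uniform bounds on `(0, σ)` (a priori estimate; every time by weak continuity)
  have hGex : ∀ n, ∃ G : ℝ → EuclideanSpace ℝ (Fin 3) → EuclideanSpace ℝ (Fin 3) →L[ℝ] EuclideanSpace ℝ (Fin 3),
      HasWeakSpatialGradientOn (slab (EuclideanSpace ℝ (Fin 3)) (Ioo 0 σ) isOpen_Ioo) (v n) G :=
    fun n => (hv n).exists_hasWeakSpatialGradientOn
  choose G hG using hGex
  have hdat : ∀ n, ∀ x₁ : EuclideanSpace ℝ (Fin 3),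
      ∫⁻ x in ball x₁ 1, ‖v₀ n x‖ₑ ^ 2 ≤ 2 * (α : ℝ≥0∞) := fun n x₁ => by
    rw [h2α]
    exact ((ha n).lintegral_ball_enorm_sq_le_of_three x₁).trans
      (add_le_add le_rfl (mul_le_mul' le_rfl (hWM n)))
  have hAPn := fun n => hAP (v₀ n) (v n) (π n) (G n) α σ σ (ha n).1
    (hv n).isLocalLeraySolutionOn (hG n) (hdat n) hσ le_rfl hσε hσα
  set Cb : ℝ≥0 := 2 * (C * α) with hCb
  have hCbE : (2 * ((C * α : ℝ≥0) : ℝ≥0∞)) = (Cb : ℝ≥0∞) := by rw [hCb]; push_cast; ring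
  have hE : ∀ n, ∀ᵐ t ∂(volume.restrict (Ioo (0 : ℝ) σ)), ∀ x₀ : EuclideanSpace ℝ (Fin 3),
      ∫⁻ x in ball x₀ 1, ‖v n t x‖ₑ ^ 2 ≤ Cb := fun n =>
    ((hAPn n).1).mono fun t ht x₀ => (ht x₀).trans hCbE.le
  have hD : ∀ n, ∀ x₀ : EuclideanSpace ℝ (Fin 3), ∫⁻ z in Ioo (0 : ℝ) σ ×ˢ ball x₀ 1,
      ENNReal.ofReal (frobeniusNormSq (G n z.1 z.2)) ≤ Cb := fun n x₀ =>
    ((hAPn n).2.1 x₀).trans (by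
      rw [← hCbE]; exact le_mul_of_one_le_left bot_le one_le_two)
  have hEt : ∀ n, ∀ t ∈ Icc 0 σ, ∀ x₀ : EuclideanSpace ℝ (Fin 3),
      ∫⁻ x in ball x₀ 1, ‖v n t x‖ₑ ^ 2 ≤ Cb := fun n =>
    (hv n).forall_lintegral_ball_le_of_ae hσ (hE n)
  have hGb : ∀ n, ∃ G : ℝ → EuclideanSpace ℝ (Fin 3) → EuclideanSpace ℝ (Fin 3) →L[ℝ] EuclideanSpace ℝ (Fin 3),
      HasWeakSpatialGradientOn (slab (EuclideanSpace ℝ (Fin 3)) (Ioo 0 σ) isOpen_Ioo) (v n) G ∧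
        ∀ x₀ : EuclideanSpace ℝ (Fin 3), ∫⁻ z in Ioo 0 σ ×ˢ ball x₀ 1,
          ENNReal.ofReal (frobeniusNormSq (G z.1 z.2)) ≤ Cb := fun n => ⟨G n, hG n, hD n⟩
  -- ### the gauged pressures at radius `3` (Kang–Miura–Tsai)
  set Ak : ℝ≥0 := 2 * α + Cb with hAk
  have hαAk : 2 * (α : ℝ≥0∞) ≤ Ak := by rw [hAk]; push_cast; exact le_self_add
  have hCbAk : (Cb : ℝ≥0∞) ≤ Ak := by rw [hAk]; push_cast; exact le_add_self
  obtain ⟨Kp, hKp⟩ := kangMiuraTsai_local_pressure_bound_holds σ 3 Ak hσ (by norm_num)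
  have hPress : ∀ n, ∀ x₀ : EuclideanSpace ℝ (Fin 3), ∃ c : ℝ → ℝ,
      MemLp c (3 / 2 : ℝ≥0∞) (volume.restrict (Ioo 0 σ)) ∧
        ∫⁻ z in Ioo 0 σ ×ˢ ball x₀ 3, ‖π n z.1 z.2 - c z.1‖ₑ ^ (3 / 2 : ℝ) ≤ Kp := fun n =>
    hKp (v₀ n) (v n) (π n) (hv n).isLocalLeraySolutionOn (fun x₀ => (hdat n x₀).trans hαAk)
      ((hv n).isWeaklyDivFree_datum hσ) ((hE n).mono fun t ht x₀ => (ht x₀).trans hCbAk)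
      ⟨G n, hG n, fun x₀ => (hD n x₀).trans hCbAk⟩
  -- ### F1: the limiting procedure on `[0, σ]`
  obtain ⟨φ, u, p, c, hφ, hc, hsuit, hp, hmeas, huC, huG, hL2, hL3, hunif, hpress⟩ :=
    seregin2014_localEnergy_limitingProcedure_holds one_pos hσ Cb v₀ v π hv hEt hGb
  have hpt : ∀ t ∈ Icc 0 σ, ∀ ψ : EuclideanSpace ℝ (Fin 3) → EuclideanSpace ℝ (Fin 3),
      FunctionSpaces.IsTestFunctionOn (⊤ : Opens (EuclideanSpace ℝ (Fin 3))) ψ →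
        Tendsto (fun k => ∫ x, ⟪v (φ k) t x, ψ x⟫) atTop (𝓝 (∫ x, ⟪u t x, ψ x⟫)) :=
    fun t ht ψ hψ => (hunif ψ hψ).tendsto_at ht
  -- ### the datum of the limit, `aL = u(0)`; it is `γ`-small in `L³(ℝ³)`
  set aL : EuclideanSpace ℝ (Fin 3) → EuclideanSpace ℝ (Fin 3) := u 0 with haL_def
  have h0 : (0 : ℝ) ∈ Icc 0 σ := ⟨le_rfl, hσ.le⟩
  have hconv0 : ∀ ψ : EuclideanSpace ℝ (Fin 3) → EuclideanSpace ℝ (Fin 3),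
      FunctionSpaces.IsTestFunctionOn (⊤ : Opens (EuclideanSpace ℝ (Fin 3))) ψ →
        Tendsto (fun k => ∫ x, ⟪v₀ (φ k) x, ψ x⟫) atTop (𝓝 (∫ x, ⟪aL x, ψ x⟫)) := by
    intro ψ hψ
    have e : ∀ k, ∫ x, ⟪v₀ (φ k) x, ψ x⟫ = ∫ x, ⟪v (φ k) 0 x, ψ x⟫ := fun k =>
      ((hv (φ k)).integral_inner_zero_eq hσ (ha (φ k)).locallyIntegrable_of_three hψ).symm
    simp_rw [e]
    exact hpt 0 h0 ψ hψ
  -- ### the limit datum is an `L² + L⁴ ∩ L^∞` field (weak compactness of weak-`L³`-bounded data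
  -- along `φ`, and uniqueness of weak limits), hence in `E²`
  have haLm : AEStronglyMeasurable aL volume := hmeas 0 h0
  have haLsq : LocallyIntegrable (fun x => ‖aL x‖ ^ 2) volume :=
    locallyIntegrable_norm_sq_of_forall_ball_le haLm ENNReal.coe_ne_top (huC 0 h0)
  have haLli : LocallyIntegrable aL volume := by
    refine ((locallyIntegrable_const (1 : ℝ)).add haLsq).mono haLm (Eventually.of_forall fun x => ?_)
    rw [Real.norm_eq_abs, Pi.add_apply]
    have h1 : ‖aL x‖ ≤ 1 + ‖aL x‖ ^ 2 := by nlinarith [norm_nonneg (aL x)]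
    exact h1.trans (le_abs_self _)
  obtain ⟨σ', gL, hL, hσ', hgL, -, hhL4, -, hhLtop, hE2sum, hconvD⟩ :=
    exists_strictMono_weakLimit_weakL3_memE2 M (fun k => v₀ (φ k)) (fun k => ha (φ k))
      (fun k => hWM (φ k))
  have hhLinf : MemLp hL ∞ volume := ⟨hhL4.1, lt_of_le_of_lt hhLtop ENNReal.one_lt_top⟩
  have hsumli : LocallyIntegrable (gL + hL) volume :=
    (hgL.locallyIntegrable one_le_two).add (hhLinf.locallyIntegrable le_top)
  have haLae : aL =ᵐ[volume] gL + hL := by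
    refine FunctionSpaces.ae_eq_of_forall_integral_inner_test_eq haLli hsumli fun ψ hψ => ?_
    exact tendsto_nhds_unique ((hconv0 ψ hψ).comp hσ'.tendsto_atTop)
      (hconvD ψ hψ.contDiff.continuous hψ.hasCompactSupport)
  have hE2aL : MemE2 aL := hE2sum.congr_ae haLae.symm haLm
  have haLCls : ∃ g h : EuclideanSpace ℝ (Fin 3) → EuclideanSpace ℝ (Fin 3),
      MemLp g 2 volume ∧ MemLp h ∞ volume ∧ aL =ᵐ[volume] g + h := ⟨gL, hL, hgL, hhLinf, haLae⟩
  have haCls : ∀ k, ∃ g h : EuclideanSpace ℝ (Fin 3) → EuclideanSpace ℝ (Fin 3),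
      MemLp g 2 volume ∧ MemLp h ∞ volume ∧ v₀ k =ᵐ[volume] g + h := fun k =>
    (ha k).exists_ae_eq_add_two_top
  have haLdiv : IsWeaklyDivFree aL :=
    IsWeaklyDivFree.of_tendsto_integral_inner (fun k => (hv (φ k)).isWeaklyDivFree_datum hσ) hconv0
  -- ### the initial layer of the limit: `‖u(t) − W_t aL‖_{L²(B(x₀,1))} ≤ η(t)`
  have hAk_top : ((Ak : ℝ≥0) : ℝ≥0∞) ≠ ∞ := ENNReal.coe_ne_top
  have hlayerL : ∀ t ∈ Ioo 0 σ, ∀ x₀ : EuclideanSpace ℝ (Fin 3),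
      eLpNorm (u t - heatTest 1 aL t) 2 (volume.restrict (ball x₀ 1)) ≤ η t := by
    intro t ht x₀
    have htI : t ∈ Icc 0 σ := ⟨ht.1.le, ht.2.le⟩
    exact eLpNorm_sub_heatTest_le_of_tendsto_of_ae_eq_add one_pos ht.1 hAk_top
      (a := fun k => v₀ (φ k)) (w := fun k => v (φ k) t)
      (fun k => haCls _) (fun k z => (hdat _ z).trans hαAk) haLCls
      (fun z => (huC 0 h0 z).trans hCbAk) hconv0 (hpt t htI) x₀
      (fun k => (hv _).memLp_two_ball htI x₀)
      (memLp_two_restrict_ball_of_lintegral_le (hmeas t htI) x₀ (huC t htI x₀))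
      fun k => hlay (φ k) t ht x₀
  have hinit : ∀ K : Set (EuclideanSpace ℝ (Fin 3)), IsCompact K →
      Tendsto (fun t => ∫⁻ x in K, ‖u t x - aL x‖ₑ ^ 2) (𝓝[>] 0) (𝓝 0) := fun K hK =>
    tendsto_lintegral_sub_datum_of_layer_of_ae_eq_add one_pos hσ hη hgL hhL4 haLae
      (fun t ht => hmeas t ⟨ht.1.le, ht.2.le⟩) hlayerL hK
  -- ### weak continuity of the limit
  have hwc : ∀ ψ : EuclideanSpace ℝ (Fin 3) → EuclideanSpace ℝ (Fin 3),
      FunctionSpaces.IsTestFunctionOn (⊤ : Opens (EuclideanSpace ℝ (Fin 3))) ψ →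
        ContinuousOn (fun t => ∫ x, ⟪u t x, ψ x⟫) (Icc 0 σ) := fun ψ hψ =>
    (hunif ψ hψ).continuousOn (Frequently.of_forall fun k => (hv (φ k)).weakContinuous ψ hψ)
  -- ### the local pressure expansion of the limit, and its decay at spatial infinity (F2)
  set w : ℕ → ℝ → EuclideanSpace ℝ (Fin 3) → EuclideanSpace ℝ (Fin 3) := fun k => v (φ k) with hw_def
  set q : ℕ → ℝ → EuclideanSpace ℝ (Fin 3) → ℝ := fun k t x => π (φ k) t x - c k t with hq_def
  have hw : ∀ k, IsLocalLeraySolutionOn σ 1 (v₀ (φ k)) (w k) (q k) := fun k =>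
    (hv (φ k)).isLocalLeraySolutionOn_sub_gauge (hc k).1 (hc k).2
  have hwC : ∀ k, ∀ᵐ t ∂(volume.restrict (Ioo (0 : ℝ) σ)),
      ∀ x₀ : EuclideanSpace ℝ (Fin 3), ∫⁻ y in ball x₀ 1, ‖w k t y‖ₑ ^ 2 ≤ Cb := fun k =>
    (ae_restrict_mem measurableSet_Ioo).mono fun t ht x₀ => hEt (φ k) t ⟨ht.1.le, ht.2.le⟩ x₀
  have huA : ∀ᵐ t ∂(volume.restrict (Ioo (0 : ℝ) σ)),
      ∀ x₀ : EuclideanSpace ℝ (Fin 3), ∫⁻ y in ball x₀ 1, ‖u t y‖ₑ ^ 2 ≤ Cb :=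
    (ae_restrict_mem measurableSet_Ioo).mono fun t ht x₀ => huC t ⟨ht.1.le, ht.2.le⟩ x₀
  have hpl : LocallyIntegrableOn (uncurry p)
      (Ioo (0 : ℝ) σ ×ˢ (univ : Set (EuclideanSpace ℝ (Fin 3)))) volume :=
    hsuit.distributional.2.2.1
  have hum : AEStronglyMeasurable (uncurry u)
      (volume.restrict (Ioo (0 : ℝ) σ ×ˢ (univ : Set (EuclideanSpace ℝ (Fin 3))))) :=
    hsuit.distributional.1.aestronglyMeasurable
  have hpm : AEStronglyMeasurable (uncurry p)
      (volume.restrict (Ioo (0 : ℝ) σ ×ˢ (univ : Set (EuclideanSpace ℝ (Fin 3))))) :=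
    hpl.aestronglyMeasurable
  -- `u ∈ L³((0,σ) × B_R)` from (7.3.2)
  have hu3 : ∀ Rb : ℝ, 0 < Rb → ∫⁻ z in Ioo 0 σ ×ˢ ball (0 : EuclideanSpace ℝ (Fin 3)) Rb,
      ‖u z.1 z.2‖ₑ ^ (3 : ℕ) < ∞ := by
    intro Rb hRb
    obtain ⟨k, hk⟩ := ((hL3 Rb hRb).eventually (gt_mem_nhds (zero_lt_one' ℝ≥0∞))).exists
    have h3k : ∫⁻ z in Ioo 0 σ ×ˢ ball (0 : EuclideanSpace ℝ (Fin 3)) Rb,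
        ‖w k z.1 z.2‖ₑ ^ (3 : ℕ) < ∞ := (hw k).lintegral_cube_box_lt_top 0 Rb
    set μB : Measure (ℝ × EuclideanSpace ℝ (Fin 3)) :=
      volume.restrict (Ioo 0 σ ×ˢ ball (0 : EuclideanSpace ℝ (Fin 3)) Rb) with hμB
    have hμB : μB ≤ volume.restrict (Ioo (0 : ℝ) σ ×ˢ (univ : Set (EuclideanSpace ℝ (Fin 3)))) :=
      Measure.restrict_mono (prod_mono Subset.rfl (subset_univ _)) le_rfl
    have hwe : AEMeasurable (fun z : ℝ × EuclideanSpace ℝ (Fin 3) => ‖w k z.1 z.2‖ₑ ^ (3 : ℕ)) μB :=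
      (((hw k).aestronglyMeasurable.mono_measure hμB).enorm.pow_const _)
    have hde : AEMeasurable (fun z : ℝ × EuclideanSpace ℝ (Fin 3) =>
        ‖w k z.1 z.2 - u z.1 z.2‖ₑ ^ (3 : ℕ)) μB :=
      ((((hw k).aestronglyMeasurable.sub hum).mono_measure hμB).enorm.pow_const _)
    have hptw : ∀ z : ℝ × EuclideanSpace ℝ (Fin 3), ‖u z.1 z.2‖ₑ ^ (3 : ℕ) ≤
        (2 : ℝ≥0∞) ^ ((3 : ℝ) - 1) * (‖w k z.1 z.2‖ₑ ^ (3 : ℕ) + ‖w k z.1 z.2 - u z.1 z.2‖ₑ ^ (3 : ℕ)) := by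
      intro z
      have hsub : ‖u z.1 z.2‖ₑ ≤ ‖w k z.1 z.2‖ₑ + ‖w k z.1 z.2 - u z.1 z.2‖ₑ := by
        have e : u z.1 z.2 = w k z.1 z.2 - (w k z.1 z.2 - u z.1 z.2) := by rw [sub_sub_cancel]
        calc ‖u z.1 z.2‖ₑ = ‖w k z.1 z.2 - (w k z.1 z.2 - u z.1 z.2)‖ₑ := by rw [← e]
          _ ≤ ‖w k z.1 z.2‖ₑ + ‖w k z.1 z.2 - u z.1 z.2‖ₑ := enorm_sub_le
      have h := ENNReal.rpow_add_le_mul_rpow_add_rpow (‖w k z.1 z.2‖ₑ) (‖w k z.1 z.2 - u z.1 z.2‖ₑ)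
        (by norm_num : (1 : ℝ) ≤ 3)
      rw [show ((3 : ℝ)) = ((3 : ℕ) : ℝ) by norm_num, ENNReal.rpow_natCast, ENNReal.rpow_natCast,
        ENNReal.rpow_natCast] at h
      exact (pow_le_pow_left' hsub 3).trans (by exact_mod_cast h)
    calc ∫⁻ z in Ioo 0 σ ×ˢ ball (0 : EuclideanSpace ℝ (Fin 3)) Rb, ‖u z.1 z.2‖ₑ ^ (3 : ℕ)
        ≤ ∫⁻ z in Ioo 0 σ ×ˢ ball (0 : EuclideanSpace ℝ (Fin 3)) Rb, (2 : ℝ≥0∞) ^ ((3 : ℝ) - 1) *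
            (‖w k z.1 z.2‖ₑ ^ (3 : ℕ) + ‖w k z.1 z.2 - u z.1 z.2‖ₑ ^ (3 : ℕ)) := lintegral_mono hptw
      _ = (2 : ℝ≥0∞) ^ ((3 : ℝ) - 1) *
            ((∫⁻ z in Ioo 0 σ ×ˢ ball (0 : EuclideanSpace ℝ (Fin 3)) Rb, ‖w k z.1 z.2‖ₑ ^ (3 : ℕ)) +
              ∫⁻ z in Ioo 0 σ ×ˢ ball (0 : EuclideanSpace ℝ (Fin 3)) Rb,
                ‖w k z.1 z.2 - u z.1 z.2‖ₑ ^ (3 : ℕ)) := by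
          have hsum : AEMeasurable (fun z : ℝ × EuclideanSpace ℝ (Fin 3) =>
              ‖w k z.1 z.2‖ₑ ^ (3 : ℕ) + ‖w k z.1 z.2 - u z.1 z.2‖ₑ ^ (3 : ℕ)) μB := hwe.add hde
          rw [lintegral_const_mul'' _ hsum, lintegral_add_left' hwe]
      _ < ∞ := ENNReal.mul_lt_top (ENNReal.rpow_lt_top_of_nonneg (by norm_num) ENNReal.ofNat_ne_top)
          (ENNReal.add_lt_top.2 ⟨h3k, hk.trans ENNReal.one_lt_top⟩)
  have hF := fun (δ : ℝ) (hδ : 0 < δ) (η' : ℝ → ℝ) (hη' : ContDiff ℝ (⊤ : ℕ∞) η')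
      (hη'c : HasCompactSupport η') (hη'T : tsupport η' ⊆ Ioo 0 σ) (c₀ e : EuclideanSpace ℝ (Fin 3)) =>
    Seregin2014Limit.limit_pgFunctional_eq_zero Cb hw hwC hpl hum huA hL2 hpress hδ hη' hη'c hη'T c₀ e
  have hexp := Seregin2014Limit.limit_ae_slice_pressure_expansion hum hpm hp ENNReal.coe_ne_top huA
    hu3 hF
  have hdecay := seregin2014_limit_decay_holds one_pos hσ Cb aL u p
    hE2aL haLdiv hsuit hp hmeas huC huG hwc hinit
    (fun x₀ r hr => hexp.mono fun t ht => ht x₀ r hr)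
  -- ### the limit is a local energy solution on `[0, σ]`
  have hsol : IsLocalEnergySolutionOn σ 1 aL u p :=
    { suitable := hsuit
      pressure := hp
      sliceMeasurable := hmeas
      uniformLocalEnergy := ⟨Cb, huC⟩
      uniformLocalGradient := huG.imp fun G hG' => ⟨hG'.1, Cb, hG'.2⟩
      weakContinuous := hwc
      initial := hinit
      decay := hdecay }
  exact ⟨Cb, φ, aL, u, p, hφ, hsol, haLdiv, hE2aL, hpt, hE, hGb, hL2⟩

end Literature.Analysis.FluidPDE

end
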